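import Summits.QuantumFields.YangMills.Theorems.ToronSmallBallOwnAxisShiftLocal
import Summits.QuantumFields.YangMills.Theorems.ToronSmallBallSiteTwist
import Summits.QuantumFields.YangMills.Theorems.ToronSmallBallSiteTwistTime
import Summits.QuantumFields.YangMills.Theorems.QuantileBitPuritySectorDensity
import HarnessLib

/-!
# The cost of a sheet shift by ONE site field on every slice of the ring: second order in the covariant-transport defects

Support module (`--supports` stmt-QuantumFields-23948, `QuantileBitPurity.HolonomyQuantileSubQuartic`; seat ym-dw-p1 g16, plan HOME
`bc/g15-dw/PLAN-CORE-GAXIS.md`, module C1).  ABSTRACT in the translate field: let `h : Site → SU(2)` be ANY site field and translate EVERY slice of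
the ring `U_0, …, U_n` by the same `h` (`siteTwist 0 h`: every `x`-link issuing from the plane `x₀ = 0` is multiplied on the left by `h x`).  Then
(`q = su2Quat`):

* §1 every plane plaquette `U_{x;0,j}` changes by at most `D² + 2Dε` (`re_trace_plaquette_siteTwist_ge`), where `ε` bounds `‖q(U_p) − 1‖` and `D` bounds
  the EDGE DEFECTS `‖q(h x) − q(U(x,j) h(x+e_j) U(x,j)⁻¹)‖` (failure of `h` to be covariantly constant along the plane links) — SECOND ORDER, via the
  abstract trace estimate `OwnAxis.re_trace_mul_ge_of_norm_sub_one_le`; hence `S(siteTwist 0 h U) − S(U) ≤ #P · (D² + 2Dε)`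
  (`wilsonAction_siteTwist_sub_le`);
* §2 interior time couplings are EXACTLY invariant (`timeCoupling_siteTwist_siteTwist`), and a bond whose second slice is translated by the
  CONJUGATED field `x ↦ g(x) h(x) g(x)⁻¹` loses at most `#E · (D_g² + 2 D_g τ)`, `D_g` a bound for the SEAM DEFECTS `‖q(h x) − q(g(x) h(x) g(x)⁻¹)‖`
  and `τ` the linkwise closeness of the bond (`timeCoupling_siteTwist_conj_ge`);
* §3 ★ `seamDensity_le_exp_mul_siteTwist`: on the ring closed through the untwisted seam `(U_n, g · U_0)` the sector density satisfies
  `w₀(U⃗, g) ≤ exp(β((n+1) · #P · (D² + 2Dε) + #E · (D_g² + 2D_g τ))) · w₀((siteTwist 0 h U_t)_t, g)` — the hypothesis `hcost` of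
  `TT.sectorWeight_indicator_le_of_translate` (the seam becomes an ordinary mismatched bond by `gaugeTransform_siteTwist`).

HONEST FRAMING: fixed-lattice inequalities; nothing about infinite volume, the continuum limit or the Clay gap.  No `sorry`, no new axiom, no new
definition.  References: [cite: Luscher1983, §2]; [cite: tHooft1979]; [cite: SeilerLNP1982, §3].
-/

set_option autoImplicit false

noncomputable section

open scoped Quaternion BigOperators
open NormedSpace Function
open Literature.MathematicalPhysics.QuantumLattice (su2Quat su2Quat_ne_zero norm_su2Quat fundamentalRep_apply)
open Literature.MathematicalPhysics.QuantumFieldTheory hiding su2Quat_mul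
open Literature.MathematicalPhysics.QuantumFieldTheory.Balaban1983to89.T4HaarSU2Translate (su2Quat_mul su2Quat_one)

namespace Summit.QuantumFields.YangMills.Theorems.FemtoTransferGap.GAxis

open ClassShift OwnAxis

variable {L : ℕ} [NeZero L]

/-! ## §1 The plaquette cost -/

omit [NeZero L] in
/-- ★ **Every plane plaquette changes at second order in the edge defect**: for a plane site `x` (`x₀ = 0`), `j ≠ 0`, a uniform plaquette bound
`‖q(U_p) − 1‖ ≤ ε` and a bound `D` for the edge defects of `h` on the plane,
`Re tr (siteTwist 0 h U)_{x;0,j} ≥ Re tr U_{x;0,j} − D² − 2Dε`. [cite: Luscher1983, §2] -/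
theorem re_trace_plaquette_siteTwist_ge (h : Site 3 L → SU2) (U : GaugeConfig 3 L SU2) {ε D : ℝ}
    (hP : ∀ (y : Site 3 L) (i j : Fin 3), ‖su2Quat (plaquetteHolonomy U y i j) - 1‖ ≤ ε)
    (hD : ∀ x : Site 3 L, x 0 = 0 → ∀ j : Fin 3, j ≠ 0 → ‖su2Quat (h x) - su2Quat (U (x, j) * h (x.shift j) * (U (x, j))⁻¹)‖ ≤ D)
    {x : Site 3 L} (hx : x 0 = 0) {j : Fin 3} (hj : j ≠ 0) :
    (((plaquetteHolonomy U x 0 j : SU2) : Matrix (Fin 2) (Fin 2) ℂ).trace).re - D ^ 2 - 2 * D * ε ≤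
      (((plaquetteHolonomy (siteTwist 0 h U) x 0 j : SU2) : Matrix (Fin 2) (Fin 2) ℂ).trace).re := by
  have hε : 0 ≤ ε := (norm_nonneg _).trans (hP x 0 j)
  have hDx := hD x hx j hj
  have hD0 : 0 ≤ D := (norm_nonneg _).trans hDx
  set M : SU2 := plaquetteHolonomy U x 0 j with hM
  set E : SU2 := U (x, j) * (h (x.shift j))⁻¹ * (U (x, j))⁻¹ * h x with hE
  -- the shifted plaquette in the trace: `Re tr(E · M)`
  have htr : (((plaquetteHolonomy (siteTwist 0 h U) x 0 j : SU2) : Matrix (Fin 2) (Fin 2) ℂ).trace).re =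
      (((E * M : SU2) : Matrix (Fin 2) (Fin 2) ℂ).trace).re := by
    have h1 := trace_plaquetteHolonomy_siteTwist_fst su2Rep 0 h U x hj.symm hx
    simp only [fundamentalRep_apply] at h1
    rw [h1]
    have hW : U (x, 0) * U (x.shift 0, j) * (U (x.shift j, 0))⁻¹ * ((h (x.shift j))⁻¹ * (U (x, j))⁻¹ * h x) = M * E := by
      rw [hM, hE]; unfold plaquetteHolonomy; group
    rw [hW, Submonoid.coe_mul, Matrix.trace_mul_comm, ← Submonoid.coe_mul]
  rw [htr]
  -- `‖q_E − 1‖ = ‖q(h x) − q(U h' U⁻¹)‖ ≤ D`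
  have hEn : ‖su2Quat E - 1‖ ≤ D := by
    have e1 : E = (U (x, j) * h (x.shift j) * (U (x, j))⁻¹)⁻¹ * h x := by rw [hE]; group
    rw [e1, su2Quat_mul, su2Quat_inv, norm_inv_mul_sub_one (norm_su2Quat _)]
    exact hDx
  have hloc := re_trace_mul_ge_of_norm_sub_one_le hEn M
  have hm : ‖su2Quat M - 1‖ ≤ ε := hP x 0 j
  have h2 : 2 * D * ‖su2Quat M - 1‖ ≤ 2 * D * ε := mul_le_mul_of_nonneg_left hm (by positivity)
  linarith

/-- ★ **Action cost of a sheet shift by a site field**: `S(siteTwist 0 h U) − S(U) ≤ #P · (D² + 2Dε)`. [cite: Luscher1983, §2] [cite: Wilson1974] -/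
theorem wilsonAction_siteTwist_sub_le (h : Site 3 L → SU2) (U : GaugeConfig 3 L SU2) {ε D : ℝ}
    (hP : ∀ (y : Site 3 L) (i j : Fin 3), ‖su2Quat (plaquetteHolonomy U y i j) - 1‖ ≤ ε)
    (hD : ∀ x : Site 3 L, x 0 = 0 → ∀ j : Fin 3, j ≠ 0 → ‖su2Quat (h x) - su2Quat (U (x, j) * h (x.shift j) * (U (x, j))⁻¹)‖ ≤ D) :
    wilsonAction su2Rep (siteTwist 0 h U) - wilsonAction su2Rep U ≤ Fintype.card (Plaquette 3 L) * (D ^ 2 + 2 * D * ε) := by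
  have hε : 0 ≤ ε := (norm_nonneg _).trans (hP 0 0 1)
  have hD0 : 0 ≤ D := (norm_nonneg _).trans (hD 0 rfl 1 one_ne_zero)
  set b : ℝ := D ^ 2 + 2 * D * ε with hb
  have hb0 : 0 ≤ b := by positivity
  rw [wilsonAction_siteTwist_sub su2Rep 0 h U]
  have hterm : ∀ p ∈ Finset.univ.filter (fun p : Plaquette 3 L => p.1 0 = 0 ∧ (p.2.1.1 = 0 ∨ p.2.1.2 = 0)),
      (su2Rep (plaquetteHolonomy U p.1 p.2.1.1 p.2.1.2)).trace.re - (su2Rep (plaquetteHolonomy (siteTwist 0 h U) p.1 p.2.1.1 p.2.1.2)).trace.re ≤ b := by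
    intro p hp
    obtain ⟨hx, hij⟩ := (Finset.mem_filter.1 hp).2
    have hlt : p.2.1.1 < p.2.1.2 := p.2.2
    have hi0 : p.2.1.1 = 0 := by
      rcases hij with h' | h'
      · exact h'
      · exfalso; rw [h'] at hlt; exact (Fin.not_lt_zero _) hlt
    have hj0 : p.2.1.2 ≠ 0 := by intro h'; rw [h'] at hlt; exact (Fin.not_lt_zero _) hlt
    simp only [fundamentalRep_apply]
    rw [hi0]
    have h := re_trace_plaquette_siteTwist_ge h U hP hD hx hj0
    linarith
  calc ∑ p ∈ Finset.univ.filter (fun p : Plaquette 3 L => p.1 0 = 0 ∧ (p.2.1.1 = 0 ∨ p.2.1.2 = 0)),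
        ((su2Rep (plaquetteHolonomy U p.1 p.2.1.1 p.2.1.2)).trace.re - (su2Rep (plaquetteHolonomy (siteTwist 0 h U) p.1 p.2.1.1 p.2.1.2)).trace.re)
      ≤ ∑ p ∈ Finset.univ.filter (fun p : Plaquette 3 L => p.1 0 = 0 ∧ (p.2.1.1 = 0 ∨ p.2.1.2 = 0)), b := Finset.sum_le_sum hterm
    _ = (Finset.univ.filter (fun p : Plaquette 3 L => p.1 0 = 0 ∧ (p.2.1.1 = 0 ∨ p.2.1.2 = 0))).card * b := by
        rw [Finset.sum_const, nsmul_eq_mul]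
    _ ≤ Fintype.card (Plaquette 3 L) * b := by
        refine mul_le_mul_of_nonneg_right ?_ hb0
        exact_mod_cast Finset.card_le_univ _

/-! ## §2 The time-like cost of a bond whose second slice carries the conjugated field -/

/-- ★ **A mismatched bond**: translating `U` by `h` and `V` by the conjugated field `x ↦ g(x) h(x) g(x)⁻¹`, with a uniform link closeness
`‖q(U_e) − q(V_e)‖ ≤ τ` and seam defects `‖q(h x) − q(g(x) h(x) g(x)⁻¹)‖ ≤ D_g` on the plane,
`T(siteTwist 0 h U, siteTwist 0 (ghg⁻¹) V) ≥ T(U, V) − #E · (D_g² + 2D_g τ)`. [cite: SeilerLNP1982, §3] [cite: Luscher1983, §2] -/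
theorem timeCoupling_siteTwist_conj_ge (h g : Site 3 L → SU2) (U V : GaugeConfig 3 L SU2) {τ Dg : ℝ}
    (hT : ∀ e : Edge 3 L, ‖su2Quat (U e) - su2Quat (V e)‖ ≤ τ)
    (hDg : ∀ x : Site 3 L, x 0 = 0 → ‖su2Quat (h x) - su2Quat (g x * h x * (g x)⁻¹)‖ ≤ Dg) :
    timeCoupling su2Rep U V - Fintype.card (Edge 3 L) * (Dg ^ 2 + 2 * Dg * τ) ≤
      timeCoupling su2Rep (siteTwist 0 h U) (siteTwist 0 (fun x => g x * h x * (g x)⁻¹) V) := by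
  have hτ : 0 ≤ τ := (norm_nonneg _).trans (hT ((0 : Site 3 L), 0))
  have hDg0 : 0 ≤ Dg := (norm_nonneg _).trans (hDg 0 rfl)
  set b : ℝ := Dg ^ 2 + 2 * Dg * τ with hb
  have hb0 : 0 ≤ b := by positivity
  have hsub := timeCoupling_siteTwist_siteTwist_sub su2Rep 0 h (fun x => g x * h x * (g x)⁻¹) U V
  have hterm : ∀ e ∈ Finset.univ.filter (fun e : Edge 3 L => e.2 = 0 ∧ e.1 0 = 0),
      -b ≤ (su2Rep (U e * (V e)⁻¹ * ((g e.1 * h e.1 * (g e.1)⁻¹)⁻¹ * h e.1))).trace.re - (su2Rep (U e * (V e)⁻¹)).trace.re := by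
    intro e he
    obtain ⟨-, hx⟩ := (Finset.mem_filter.1 he).2
    simp only [fundamentalRep_apply]
    set M : SU2 := U e * (V e)⁻¹ with hM
    set E : SU2 := (g e.1 * h e.1 * (g e.1)⁻¹)⁻¹ * h e.1 with hE
    have hcyc : (((M * E : SU2) : Matrix (Fin 2) (Fin 2) ℂ).trace).re = (((E * M : SU2) : Matrix (Fin 2) (Fin 2) ℂ).trace).re := by
      rw [Submonoid.coe_mul, Matrix.trace_mul_comm, ← Submonoid.coe_mul]
    rw [hcyc]
    have hEn : ‖su2Quat E - 1‖ ≤ Dg := by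
      rw [hE, su2Quat_mul, su2Quat_inv, norm_inv_mul_sub_one (norm_su2Quat _)]
      exact hDg e.1 hx
    have hloc := re_trace_mul_ge_of_norm_sub_one_le hEn M
    have hm : ‖su2Quat M - 1‖ ≤ τ := by rw [hM, ← norm_su2Quat_sub_eq]; exact hT e
    have h2 : 2 * Dg * ‖su2Quat M - 1‖ ≤ 2 * Dg * τ := mul_le_mul_of_nonneg_left hm (by positivity)
    rw [hb]
    linarith
  have hsum : -(Fintype.card (Edge 3 L) * b) ≤ ∑ e ∈ Finset.univ.filter (fun e : Edge 3 L => e.2 = 0 ∧ e.1 0 = 0),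
      ((su2Rep (U e * (V e)⁻¹ * ((g e.1 * h e.1 * (g e.1)⁻¹)⁻¹ * h e.1))).trace.re - (su2Rep (U e * (V e)⁻¹)).trace.re) := by
    have h1 : ∑ e ∈ Finset.univ.filter (fun e : Edge 3 L => e.2 = 0 ∧ e.1 0 = 0), (-b) ≤ _ := Finset.sum_le_sum hterm
    rw [Finset.sum_const, smul_neg, nsmul_eq_mul] at h1
    refine le_trans ?_ h1
    have hc : ((Finset.univ.filter (fun e : Edge 3 L => e.2 = 0 ∧ e.1 0 = 0)).card : ℝ) ≤ Fintype.card (Edge 3 L) := by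
      exact_mod_cast Finset.card_le_univ _
    nlinarith
  linarith

/-! ## §3 The whole ring through the untwisted seam -/

/-- ★ **The cost of translating every slice by one site field, as one exponent.**  On the ring of `n+1` slices closed through the untwisted seam
`(U_n, g·U_0)`, assume uniform plaquette bounds `‖q((U_t)_p) − 1‖ ≤ ε`, seam closeness `‖q((U_n)_e) − q((g·U_0)_e)‖ ≤ τ`, edge defects of `h`
at most `D` on every slice and seam defects at most `D_g`.  Then for `β ≥ 0`
`w₀(U⃗, g) ≤ exp(β((n+1) · #P · (D² + 2Dε) + #E · (D_g² + 2D_g τ))) · w₀((siteTwist 0 h U_t)_t, g)` — interior bonds cost nothing.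
[cite: Luscher1983, §2] [cite: SeilerLNP1982, §3] [cite: tHooft1979] -/
theorem seamDensity_le_exp_mul_siteTwist {β : ℝ} (hβ : 0 ≤ β) (h : Site 3 L → SU2) {ε τ D Dg : ℝ} {n : ℕ}
    (Us : Fin (n + 1) → GaugeConfig 3 L SU2) (g : Site 3 L → SU2)
    (hP : ∀ (t : Fin (n + 1)) (y : Site 3 L) (i j : Fin 3), ‖su2Quat (plaquetteHolonomy (Us t) y i j) - 1‖ ≤ ε)
    (hTs : ∀ e : Edge 3 L, ‖su2Quat (Us (Fin.last n) e) - su2Quat (gaugeTransform g (Us 0) e)‖ ≤ τ)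
    (hD : ∀ (t : Fin (n + 1)) (x : Site 3 L), x 0 = 0 → ∀ j : Fin 3, j ≠ 0 →
      ‖su2Quat (h x) - su2Quat (Us t (x, j) * h (x.shift j) * (Us t (x, j))⁻¹)‖ ≤ D)
    (hDg : ∀ x : Site 3 L, x 0 = 0 → ‖su2Quat (h x) - su2Quat (g x * h x * (g x)⁻¹)‖ ≤ Dg) :
    (∏ i : Fin n, transferKernel su2Rep β (Us i.castSucc) (Us i.succ)) *
        transferKernel su2Rep β (Us (Fin.last n)) (gaugeTransform g (TT.twist3 (fun _ => false) (Us 0))) ≤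
      Real.exp (β * ((n + 1 : ℕ) * (Fintype.card (Plaquette 3 L) * (D ^ 2 + 2 * D * ε)) + Fintype.card (Edge 3 L) * (Dg ^ 2 + 2 * Dg * τ))) *
        ((∏ i : Fin n, transferKernel su2Rep β (siteTwist 0 h (Us i.castSucc)) (siteTwist 0 h (Us i.succ))) *
          transferKernel su2Rep β (siteTwist 0 h (Us (Fin.last n))) (gaugeTransform g (TT.twist3 (fun _ => false) (siteTwist 0 h (Us 0))))) := by
  set bP : ℝ := D ^ 2 + 2 * D * ε with hbP
  set bT : ℝ := Dg ^ 2 + 2 * Dg * τ with hbT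
  have hmain := TT.seamDensity_le_exp_mul (L := L) β (fun _ => false) Us (fun t => siteTwist 0 h (Us t)) g
    (Q := β * ((n + 1 : ℕ) * (Fintype.card (Plaquette 3 L) * bP) + Fintype.card (Edge 3 L) * bT)) ?_
  · simpa only using hmain
  simp only [TT.twist3_false]
  -- actions up by ≤ #P bP per slice
  have hS : ∀ t : Fin (n + 1), wilsonAction su2Rep (siteTwist 0 h (Us t)) - wilsonAction su2Rep (Us t) ≤ Fintype.card (Plaquette 3 L) * bP :=
    fun t => wilsonAction_siteTwist_sub_le h (Us t) (hP t) (hD t)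
  -- interior couplings unchanged
  have hTint : ∀ i : Fin n, timeCoupling su2Rep (siteTwist 0 h (Us i.castSucc)) (siteTwist 0 h (Us i.succ)) = timeCoupling su2Rep (Us i.castSucc) (Us i.succ) :=
    fun i => timeCoupling_siteTwist_siteTwist su2Rep 0 h _ _
  -- the seam bond: the gauge image of the translated slice carries the conjugated field
  have hTseam : timeCoupling su2Rep (Us (Fin.last n)) (gaugeTransform g (Us 0)) - Fintype.card (Edge 3 L) * bT ≤
      timeCoupling su2Rep (siteTwist 0 h (Us (Fin.last n))) (gaugeTransform g (siteTwist 0 h (Us 0))) := by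
    rw [gaugeTransform_siteTwist]
    exact timeCoupling_siteTwist_conj_ge h g _ _ hTs hDg
  have hsumS : ∑ t : Fin (n + 1), wilsonAction su2Rep (siteTwist 0 h (Us t)) - ∑ t : Fin (n + 1), wilsonAction su2Rep (Us t) ≤
      (n + 1 : ℕ) * (Fintype.card (Plaquette 3 L) * bP) := by
    rw [← Finset.sum_sub_distrib]
    exact (Finset.sum_le_card_nsmul _ _ (Fintype.card (Plaquette 3 L) * bP) fun t _ => hS t).trans (by simp)
  have hsumT : ∑ i : Fin n, timeCoupling su2Rep (siteTwist 0 h (Us i.castSucc)) (siteTwist 0 h (Us i.succ)) =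
      ∑ i : Fin n, timeCoupling su2Rep (Us i.castSucc) (Us i.succ) := Finset.sum_congr rfl fun i _ => hTint i
  rw [hsumT]
  have hkey : (∑ i : Fin n, timeCoupling su2Rep (Us i.castSucc) (Us i.succ)) + timeCoupling su2Rep (Us (Fin.last n)) (gaugeTransform g (Us 0))
        - ∑ t : Fin (n + 1), wilsonAction su2Rep (Us t)
      - ((∑ i : Fin n, timeCoupling su2Rep (Us i.castSucc) (Us i.succ)) +
          timeCoupling su2Rep (siteTwist 0 h (Us (Fin.last n))) (gaugeTransform g (siteTwist 0 h (Us 0)))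
        - ∑ t : Fin (n + 1), wilsonAction su2Rep (siteTwist 0 h (Us t))) ≤
      (n + 1 : ℕ) * (Fintype.card (Plaquette 3 L) * bP) + Fintype.card (Edge 3 L) * bT := by
    linarith [hsumS, hTseam]
  calc β * ((∑ i : Fin n, timeCoupling su2Rep (Us i.castSucc) (Us i.succ)) + timeCoupling su2Rep (Us (Fin.last n)) (gaugeTransform g (Us 0))) -
          β * ∑ t : Fin (n + 1), wilsonAction su2Rep (Us t) -
        (β * ((∑ i : Fin n, timeCoupling su2Rep (Us i.castSucc) (Us i.succ)) +
            timeCoupling su2Rep (siteTwist 0 h (Us (Fin.last n))) (gaugeTransform g (siteTwist 0 h (Us 0)))) -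
          β * ∑ t : Fin (n + 1), wilsonAction su2Rep (siteTwist 0 h (Us t)))
      = β * ((∑ i : Fin n, timeCoupling su2Rep (Us i.castSucc) (Us i.succ)) + timeCoupling su2Rep (Us (Fin.last n)) (gaugeTransform g (Us 0))
        - ∑ t : Fin (n + 1), wilsonAction su2Rep (Us t)
      - ((∑ i : Fin n, timeCoupling su2Rep (Us i.castSucc) (Us i.succ)) +
          timeCoupling su2Rep (siteTwist 0 h (Us (Fin.last n))) (gaugeTransform g (siteTwist 0 h (Us 0)))
        - ∑ t : Fin (n + 1), wilsonAction su2Rep (siteTwist 0 h (Us t)))) := by ring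
    _ ≤ β * ((n + 1 : ℕ) * (Fintype.card (Plaquette 3 L) * bP) + Fintype.card (Edge 3 L) * bT) := mul_le_mul_of_nonneg_left hkey hβ

end Summit.QuantumFields.YangMills.Theorems.FemtoTransferGap.GAxis

end
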